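import Mathlib
import Literature.AlgebraicGeometry.Resolution.CobordantBlowupFiltration
import Summits.ResolutionOfSingularities.ResolutionOfSingularities.Theorems.WeightedInvariantDatumToEmbeddedGradedFiniteness
import HarnessLib

/-!
# Degree-zero parts of a homogeneous filtration: standard-graded Veronese tails

Topic: `Summits/ResolutionOfSingularities/ResolutionOfSingularities/Theorems`. Pure commutative
algebra for stub `stub_qs_degree` of the line `Sketch` of the crux
`Theses.WeightedInvariant.DatumToEmbedded` (statement `stmt-ResolutionOfSingularities-0572`) of the
summit `Summit.ResolutionOfSingularities.ResolutionOfSingularities`; the stub itself is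
`Theorems/WeightedInvariantDatumToEmbeddedDegree.lean`.

Setting: a commutative `C`-algebra `A` graded by an abelian group `M` through additive subgroups
`𝒜 χ` (Mathlib `GradedRing`, the graded encoding of a `𝔾ₘʲ`-action on an affine chart) with the
scalars in degree `0`, and a descending multiplicative filtration `F` of ideals `Jₙ` of `A`
(`IdealFiltration`, the pieces of a Rees algebra). The quotient step of the cobordant tower needs a
Veronese degree `d` for which the DEGREE-ZERO parts `Tₙ := Jₙ ∩ A₀` are generated in degree one:
`T_{d(l+1)} ⊆ T_d · T_{dl}`. This file supplies the finiteness behind it, in monomial form: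

* `exists_homogeneous_adjoin_eq_top`, `le_span_monomials'` — a finitely generated graded algebra has
  homogeneous generators `zₖ ∈ A_{eₖ}`, and `A_μ` is the `C`-span of the monomials `z^α` of degree
  `∑ αₖ eₖ = μ` (the `AddSubgroup`-graded forms of the lemmas of `…GradedFiniteness`);
* `exists_tail_veronese` — **tails of a weighted polynomial ring are eventually standard**: for
  `S = C[X_b]` weighted by `w`, some `d > 0` has `S_{N'} ⊆ S_{d'} · S_{N'-d'}` for every multiple
  `d'` of `d`, every `l ≥ 1` and every `N' ≥ d'(l+1)` (pigeonhole,
  `GradedFiniteness.piece_add_mul_le`);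
* `map_weightedHomogeneousSubmodule_le`, `iSup_map_le_mul` — pushing this forward along
  `X_b ↦ g_b ∈ T_{w_b}` for any multiplicative antitone family `T` of `C`-submodules;
* `exists_degreeZero_generators` — **invariants of the Rees algebra are finitely generated**
  (Gordan/Dickson, `GradedFiniteness.exists_finite_weightZero_generators`): if homogeneous
  `zₖ ∈ J_{nₖ} ∩ A_{eₖ}` generate `A` over `C` and every `J_N` is spanned over `A` by the monomials
  `z^α` with `∑ αₖ nₖ ≥ N`, then finitely many degree-`0` monomials `g_b = z^{b} ∈ J_{w_b} ∩ A₀`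
  have `J_N ∩ A₀ ⊆ ∑_{N' ≥ N} g(S_{N'})`.

All proofs are glue on Mathlib and the tree; no definitions, no named facts.
-/

set_option linter.dupNamespace false -- mandated namespace `…Theorems.DatumToEmbedded.<Topic>`

namespace Summit.ResolutionOfSingularities.ResolutionOfSingularities.Theorems.DatumToEmbedded.Degree

open DirectSum MvPolynomial Literature.AlgebraicGeometry.Resolution

/-! ## Homogeneous generators and monomials for `AddSubgroup`-gradings -/

section Graded

variable {C A M : Type} [CommRing C] [CommRing A] [Algebra C A] [DecidableEq M] [AddCommGroup M]
  (𝒜 : M → AddSubgroup A) [GradedRing 𝒜]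

/-- A finitely generated algebra graded by ADDITIVE SUBGROUPS (Mathlib `GradedRing`, not
`GradedAlgebra`) is generated by a finite family of **homogeneous** elements: the homogeneous
components of any finite generating set (the `AddSubgroup`-graded form of
`GradedFiniteness.exists_homogeneous_generators`). [folklore] -/
theorem exists_homogeneous_adjoin_eq_top (h : Algebra.FiniteType C A) :
    ∃ (ι : Type) (_ : Fintype ι) (x : ι → A) (e : ι → M),
      Algebra.adjoin C (Set.range x) = ⊤ ∧ ∀ i, x i ∈ 𝒜 (e i) := by
  classical
  obtain ⟨s, hs⟩ := h.out
  refine ⟨(a : ↥s) × ↥(decompose 𝒜 (a : A)).support, inferInstance,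
    fun p => (decompose 𝒜 (p.1 : A) (p.2 : M) : A), fun p => (p.2 : M), ?_,
    fun p => SetLike.coe_mem _⟩
  rw [eq_top_iff, ← hs]
  refine Algebra.adjoin_le fun a ha => ?_
  rw [SetLike.mem_coe, ← sum_support_decompose 𝒜 a]
  exact Subalgebra.sum_mem _ fun μ hμ => Algebra.subset_adjoin ⟨⟨⟨a, ha⟩, ⟨μ, hμ⟩⟩, rfl⟩

/-- Homogeneous components against a homogeneous right factor: `(a b)_n = a_{n-j} b` for
`b ∈ A_j`. [folklore] -/
theorem decompose_mul_of_mem {a b : A} {n j : M} (hb : b ∈ 𝒜 j) :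
    (decompose 𝒜 (a * b) n : A) = decompose 𝒜 a (n - j) * b := by
  have h := coe_decompose_mul_add_of_right_mem (𝒜 := 𝒜) (a := a) (i := n - j) hb
  rwa [sub_add_cancel] at h

variable (h0 : ∀ c : C, algebraMap C A c ∈ 𝒜 0)

include h0 in
/-- With the scalars in degree `0`, taking homogeneous components is `C`-linear. [folklore] -/
theorem decompose_smul (c : C) (r : A) (μ : M) :
    (decompose 𝒜 (c • r) μ : A) = c • (decompose 𝒜 r μ : A) := by
  rw [Algebra.smul_def, Algebra.smul_def, coe_decompose_mul_of_left_mem_zero 𝒜 (h0 c)]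

variable {ι : Type} [Fintype ι] (x : ι → A) (e : ι → M)

include h0 in
/-- **Graded pieces are spanned by monomials**: if homogeneous `xᵢ ∈ A_{eᵢ}` generate `A` over
`C` (scalars in degree `0`), every `r ∈ A_μ` is a `C`-combination of the monomials `∏ xᵢ ^ αᵢ` of
degree `∑ αᵢ • eᵢ = μ` (project a `C`-combination of monomials to degree `μ`). [folklore] -/
theorem le_span_monomials' (hx : ∀ i, x i ∈ 𝒜 (e i))
    (hgen : Algebra.adjoin C (Set.range x) = ⊤) (μ : M) {r : A} (hr : r ∈ 𝒜 μ) :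
    r ∈ Submodule.span C {m | ∃ α : ι → ℕ, ∑ i, α i • e i = μ ∧ m = ∏ i, x i ^ α i} := by
  have key : ∀ s ∈ Subalgebra.toSubmodule (Algebra.adjoin C (Set.range x)), ∀ ν : M,
      (decompose 𝒜 s ν : A) ∈
        Submodule.span C {m | ∃ α : ι → ℕ, ∑ i, α i • e i = ν ∧ m = ∏ i, x i ^ α i} := by
    intro s hs
    rw [Algebra.adjoin_eq_span] at hs
    induction hs using Submodule.span_induction with
    | mem m hm =>
      intro ν
      obtain ⟨α, rfl⟩ := Submonoid.mem_closure_range_iff_of_fintype.1 hm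
      have hmon : ∏ i, x i ^ α i ∈ 𝒜 (∑ i, α i • e i) :=
        SetLike.prod_mem_graded 𝒜 (fun i => α i • e i) (fun i => x i ^ α i) fun i _ =>
          SetLike.pow_mem_graded (α i) (hx i)
      by_cases hα : ∑ i, α i • e i = ν
      · rw [decompose_of_mem_same 𝒜 (hα ▸ hmon)]
        exact Submodule.subset_span ⟨α, hα, rfl⟩
      · rw [decompose_of_mem_ne 𝒜 hmon hα]
        exact zero_mem _
    | zero =>
      intro ν
      rw [decompose_zero, DirectSum.zero_apply, ZeroMemClass.coe_zero]
      exact zero_mem _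
    | add s t _ _ hs ht =>
      intro ν
      rw [decompose_add, DirectSum.add_apply, AddMemClass.coe_add]
      exact add_mem (hs ν) (ht ν)
    | smul c s _ hs =>
      intro ν
      rw [decompose_smul 𝒜 h0]
      exact Submodule.smul_mem _ c (hs ν)
  have hr' : r ∈ Subalgebra.toSubmodule (Algebra.adjoin C (Set.range x)) := by
    rw [hgen, Algebra.top_toSubmodule]
    exact Submodule.mem_top
  have h := key r hr' μ
  rwa [decompose_of_mem_same 𝒜 hr] at h

end Graded

/-! ## Tails of a weighted polynomial ring are eventually standard graded -/

section TailVeronese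

variable (C : Type) [CommRing C] {σ : Type} [Fintype σ] (w : σ → ℕ)

/-- **Tails of a finitely generated weighted polynomial ring are eventually standard**: for
`S = C[X_b : b ∈ σ]` graded by the weights `w`, there is `d > 0` such that for every multiple `d'`
of `d`, every `l ≥ 1` and every `N' ≥ d'(l+1)`, `S_{N'} ⊆ S_{d'} · S_{N'-d'}`. With
`h = (∑ w)!` and `d = (#σ + 1) h`: write `N' = n + jh` with `#σ·h ≤ n < d`; then
`S_{N'} ⊆ S_h^j S_n` (`GradedFiniteness.piece_add_mul_le`) and `jh ≥ d'`. [folklore; Bourbaki,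
Alg. Comm. III §1 no. 3] -/
theorem exists_tail_veronese :
    ∃ d : ℕ, 0 < d ∧ ∀ d' : ℕ, d ∣ d' → ∀ l : ℕ, 0 < l → ∀ N' : ℕ, d' * (l + 1) ≤ N' →
      weightedHomogeneousSubmodule C w N' ≤
        weightedHomogeneousSubmodule C w d' * weightedHomogeneousSubmodule C w (N' - d') := by
  classical
  letI : GradedAlgebra (weightedHomogeneousSubmodule C w) := weightedGradedAlgebra C w
  set 𝒮 : ℕ → Submodule C (MvPolynomial σ C) := weightedHomogeneousSubmodule C w with h𝒮
  have hx : ∀ i, (X i : MvPolynomial σ C) ∈ 𝒮 (w i) := fun i => isWeightedHomogeneous_X C w i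
  have hgen : Algebra.adjoin C (Set.range (X : σ → MvPolynomial σ C)) = ⊤ := adjoin_range_X
  set h := (∑ i, w i).factorial with hh_def
  have hh : 0 < h := Nat.factorial_pos _
  have hdvd : ∀ i, 0 < w i → w i ∣ h := fun i hi =>
    Nat.dvd_factorial hi (Finset.single_le_sum (fun j _ => Nat.zero_le (w j)) (Finset.mem_univ i))
  set q := Fintype.card σ with hq
  refine ⟨(q + 1) * h, Nat.mul_pos (Nat.succ_pos _) hh, ?_⟩
  rintro d' ⟨c, rfl⟩ l hl N' hN'
  rcases Nat.eq_zero_or_pos c with rfl | hc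
  · intro s hs
    rw [mul_zero, Nat.sub_zero]
    simpa only [one_mul] using Submodule.mul_mem_mul (SetLike.one_mem_graded 𝒮) hs
  -- abbreviations for the arithmetic
  set H := (q + 1) * h with hH
  have hHq : q * h + h = H := by rw [hH]; ring
  have hb : H ≤ H * c * l := Nat.le_mul_of_pos_right _ hl |>.trans' (Nat.le_mul_of_pos_right _ hc)
  have hN'' : H * c * l + H * c ≤ N' := by rw [← Nat.mul_succ]; exact hN'
  have hqN : q * h ≤ N' := by
    have : q * h ≤ H := by rw [← hHq]; exact Nat.le_add_right _ _
    omega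
  -- `N' = n + j h` with `q h ≤ n < q h + h`
  set j := (N' - q * h) / h with hj
  have hjle : j * h ≤ N' - q * h := Nat.div_mul_le_self _ _
  have hjlt : N' - q * h < j * h + h := Nat.lt_div_mul_add hh
  set n := N' - j * h with hn
  have hnq : q * h ≤ n := by omega
  have hnH : n < H := by omega
  have hN'eq : N' = n + j * h := by omega
  -- `j ≥ j₁ := (q + 1) c`, `j₁ h = d'`
  have hj₁h : (q + 1) * c * h = H * c := by rw [hH]; ring
  have hj₁ : (q + 1) * c ≤ j := by
    by_contra hcon
    have h1 : j * h ≤ (q + 1) * c * h := Nat.mul_le_mul_right _ (not_le.mp hcon).le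
    omega
  have hpiece : 𝒮 (n + j * h) ≤ 𝒮 h ^ j * 𝒮 n :=
    GradedFiniteness.piece_add_mul_le 𝒮 X w hx hgen hh hdvd hnq j
  calc 𝒮 N' = 𝒮 (n + j * h) := by rw [← hN'eq]
    _ ≤ 𝒮 h ^ j * 𝒮 n := hpiece
    _ = 𝒮 h ^ ((q + 1) * c) * (𝒮 h ^ (j - (q + 1) * c) * 𝒮 n) := by
        rw [← mul_assoc, ← pow_add, Nat.add_sub_cancel' hj₁]
    _ ≤ 𝒮 ((q + 1) * c * h) * (𝒮 ((j - (q + 1) * c) * h) * 𝒮 n) :=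
        mul_le_mul' (GradedFiniteness.pow_le_piece 𝒮 h _)
          (mul_le_mul' (GradedFiniteness.pow_le_piece 𝒮 h _) le_rfl)
    _ ≤ 𝒮 ((q + 1) * c * h) * 𝒮 ((j - (q + 1) * c) * h + n) :=
        mul_le_mul' le_rfl (GradedFiniteness.mul_le_piece 𝒮 _ _)
    _ = 𝒮 (H * c) * 𝒮 (N' - H * c) := by
        have h2 : (j - (q + 1) * c) * h + n = N' - H * c := by
          rw [Nat.sub_mul, hj₁h]
          have h3 : H * c ≤ j * h := by rw [← hj₁h]; exact Nat.mul_le_mul_right _ hj₁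
          omega
        rw [hj₁h, h2]

end TailVeronese

/-! ## Pushing forward along degree-zero generators -/

section Transfer

variable {C A : Type} [CommRing C] [CommRing A] [Algebra C A] (T : ℕ → Submodule C A)
  [SetLike.GradedMonoid T] {σ : Type} [Fintype σ] (g : σ → A) (w : σ → ℕ)
  (hg : ∀ b, g b ∈ T (w b))

include hg in
/-- For a multiplicative family `T` of submodules (`1 ∈ T₀`, `T_a T_b ⊆ T_{a+b}`) and elements
`g_b ∈ T_{w_b}`, the evaluation `X_b ↦ g_b` maps the weight-`N` polynomials into `T_N`.
[folklore] -/
theorem map_weightedHomogeneousSubmodule_le (N : ℕ) :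
    (weightedHomogeneousSubmodule C w N).map (aeval g).toLinearMap ≤ T N := by
  classical
  rintro _ ⟨p, hp, rfl⟩
  rw [SetLike.mem_coe, mem_weightedHomogeneousSubmodule] at hp
  rw [AlgHom.toLinearMap_apply, p.as_sum, map_sum]
  refine Submodule.sum_mem _ fun d hd => ?_
  rw [aeval_monomial, ← Algebra.smul_def]
  refine Submodule.smul_mem _ _ ?_
  have hwd : Finsupp.weight w d = N := hp (mem_support_iff.mp hd)
  rw [Finsupp.prod_fintype _ _ (fun i => pow_zero _)]
  have hmem := SetLike.prod_mem_graded T (fun i => d i • w i) (fun i => g i ^ d i)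
    (F := Finset.univ) fun i _ => SetLike.pow_mem_graded (d i) (hg i)
  have hsum : ∑ i, d i • w i = N := by
    rw [← hwd, Finsupp.weight_apply,
      Finsupp.sum_fintype d (fun i c => c • w i) fun i => zero_smul ℕ _]
  rwa [hsum] at hmem

include hg in
/-- **Transfer of the tail-Veronese property**: if `S_{N'} ⊆ S_{d'} S_{N'-d'}` for all
`N' ≥ d'(l+1)` in the weighted polynomial ring, then, for `T` antitone,
`∑_{N' ≥ d'(l+1)} g(S_{N'}) ⊆ T_{d'} · T_{d'l}`. [folklore] -/
theorem iSup_map_le_mul (hT : Antitone T) (d' l : ℕ)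
    (hV : ∀ N' : ℕ, d' * (l + 1) ≤ N' → weightedHomogeneousSubmodule C w N' ≤
      weightedHomogeneousSubmodule C w d' * weightedHomogeneousSubmodule C w (N' - d')) :
    (⨆ (N' : ℕ) (_ : d' * (l + 1) ≤ N'),
      (weightedHomogeneousSubmodule C w N').map (aeval g).toLinearMap) ≤ T d' * T (d' * l) := by
  refine iSup₂_le fun N' hN' => ?_
  refine (Submodule.map_mono (hV N' hN')).trans ?_
  rw [Submodule.map_mul]
  refine mul_le_mul' (map_weightedHomogeneousSubmodule_le T g w hg d')
    ((map_weightedHomogeneousSubmodule_le T g w hg _).trans (hT ?_))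
  rw [Nat.mul_succ] at hN'
  omega

end Transfer

/-! ## Degree-zero generators (Gordan/Dickson) -/

section DegreeZero

variable {C A M : Type} [CommRing C] [CommRing A] [Algebra C A] [DecidableEq M] [AddCommGroup M]
  (𝒜 : M → AddSubgroup A) [GradedRing 𝒜] (h0 : ∀ c : C, algebraMap C A c ∈ 𝒜 0)
  (F : IdealFiltration A)
  {κ : Type} [Fintype κ] (z : κ → A) (e : κ → M) (n : κ → ℕ)
  (hz : ∀ k, z k ∈ F.ideal (n k)) (hze : ∀ k, z k ∈ 𝒜 (e k))
  (hgen : Algebra.adjoin C (Set.range z) = ⊤)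
  (hspan : ∀ (N : ℕ) (x : A), x ∈ F.ideal N →
    x ∈ Ideal.span {m | ∃ α : κ → ℕ, N ≤ ∑ k, α k * n k ∧ m = ∏ k, z k ^ α k})

include hz in
/-- Monomials in elements `zₖ ∈ J_{nₖ}` of a multiplicative filtration: `z^α ∈ J_{∑ αₖ nₖ}`.
[folklore] -/
theorem prod_pow_mem_ideal (α : κ → ℕ) : ∏ k, z k ^ α k ∈ F.ideal (∑ k, α k * n k) := by
  haveI : SetLike.GradedMonoid F.ideal :=
    { one_mem := by rw [F.ideal_zero]; trivial
      mul_mem := fun i j a b ha hb => F.mul_le i j (Ideal.mul_mem_mul ha hb) }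
  have h := SetLike.prod_mem_graded F.ideal (fun k => α k • n k) (fun k => z k ^ α k)
    (F := Finset.univ) fun k _ => SetLike.pow_mem_graded (α k) (hz k)
  simpa only [smul_eq_mul] using h

include h0 hz hze hgen hspan in
/-- **Invariants of the Rees algebra are finitely generated** (Gordan/Dickson form). Let
homogeneous `zₖ ∈ J_{nₖ} ∩ A_{eₖ}` generate `A` over `C` (scalars in degree `0`), with every `J_N`
spanned over `A` by the monomials `z^α`, `∑ αₖ nₖ ≥ N`. The exponent vectors of degree
`∑ αₖ eₖ = 0` are generated by a finite set `B` (`exists_finite_weightZero_generators`); the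
degree-`0` monomials `g_b := z^b ∈ J_{w_b} ∩ A₀`, `w_b := ∑ bₖ nₖ`, then satisfy
`J_N ∩ A₀ ⊆ ∑_{N' ≥ N} g(S_{N'})` for the weighted polynomial ring `S = C[X_b]`: project an
`A`-combination of the `z^α` to degree `0` (coefficients become `C`-combinations of monomials of
the opposite degree) and factor each degree-`0` monomial through `B`. [folklore; Mumford GIT
Thm 1.1, diagonalizable case] -/
theorem exists_degreeZero_generators :
    ∃ (σ : Type) (_ : Fintype σ) (g : σ → A) (w : σ → ℕ),
      (∀ b, g b ∈ F.ideal (w b)) ∧ (∀ b, g b ∈ 𝒜 0) ∧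
      ∀ (N : ℕ) (x : A), x ∈ F.ideal N → x ∈ 𝒜 0 →
        x ∈ ⨆ (N' : ℕ) (_ : N ≤ N'),
          (weightedHomogeneousSubmodule C w N').map (aeval g).toLinearMap := by
  classical
  -- monomials in the `z` are homogeneous
  have hzmon : ∀ α : κ → ℕ, ∏ k, z k ^ α k ∈ 𝒜 (∑ k, α k • e k) := fun α =>
    SetLike.prod_mem_graded 𝒜 (fun k => α k • e k) (fun k => z k ^ α k) fun k _ =>
      SetLike.pow_mem_graded (α k) (hze k)
  obtain ⟨B, hBfin, hB0, hBgen⟩ := GradedFiniteness.exists_finite_weightZero_generators e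
  haveI : Fintype B := hBfin.fintype
  refine ⟨B, inferInstance, fun b => ∏ k, z k ^ (b : κ → ℕ) k,
    fun b => ∑ k, (b : κ → ℕ) k * n k, fun b => prod_pow_mem_ideal F z n hz _, fun b => ?_, ?_⟩
  · have h := hzmon (b : κ → ℕ)
    rwa [hB0 _ b.2] at h
  intro N x hxN hx0
  -- degree-`0` monomials of `z`-weight `≥ N` lie in the target
  have hmon : ∀ v : κ → ℕ, ∑ k, v k • e k = 0 → N ≤ ∑ k, v k * n k →
      ∏ k, z k ^ v k ∈ ⨆ (N' : ℕ) (_ : N ≤ N'),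
        (weightedHomogeneousSubmodule C (fun b : B => ∑ k, (b : κ → ℕ) k * n k) N').map
          (aeval (fun b : B => ∏ k, z k ^ (b : κ → ℕ) k)).toLinearMap := by
    intro v hv0 hvN
    obtain ⟨γ, hγ⟩ := (AddSubmonoid.mem_closure_iff_of_fintype (s := B)).1 (hBgen v hv0)
    have hγk : ∀ k, v k = ∑ b : B, γ b * (b : κ → ℕ) k := fun k => by
      rw [hγ, Finset.sum_apply]
      simp only [Pi.smul_apply, smul_eq_mul]
    have hprod : ∏ k, z k ^ v k = ∏ b : B, (∏ k, z k ^ (b : κ → ℕ) k) ^ γ b := by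
      simp_rw [hγk, ← Finset.prod_pow_eq_pow_sum, ← Finset.prod_pow]
      rw [Finset.prod_comm]
      refine Finset.prod_congr rfl fun b _ => Finset.prod_congr rfl fun k _ => ?_
      rw [mul_comm, pow_mul]
    set γ' : B →₀ ℕ := Finsupp.equivFunOnFinite.symm γ with hγ'
    have hγ'' : ∀ b, γ' b = γ b := fun b => rfl
    have hw : N ≤ Finsupp.weight (fun b : B => ∑ k, (b : κ → ℕ) k * n k) γ' := by
      rw [Finsupp.weight_apply,
        Finsupp.sum_fintype γ' (fun b c => c • ∑ k, (b : κ → ℕ) k * n k) fun _ => zero_smul ℕ _]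
      simp only [hγ'', smul_eq_mul, Finset.mul_sum]
      rw [Finset.sum_comm]
      refine hvN.trans (le_of_eq (Finset.sum_congr rfl fun k _ => ?_))
      rw [hγk, Finset.sum_mul]
      exact Finset.sum_congr rfl fun b _ => by ring
    refine Submodule.mem_iSup_of_mem _ (Submodule.mem_iSup_of_mem hw ⟨monomial γ' 1, ?_, ?_⟩)
    · exact (mem_weightedHomogeneousSubmodule _ _ _ _).2 (isWeightedHomogeneous_monomial _ _ _ rfl)
    · rw [AlgHom.toLinearMap_apply, aeval_monomial, map_one, one_mul,
        Finsupp.prod_fintype _ _ (fun _ => pow_zero _), hprod]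
      exact Finset.prod_congr rfl fun b _ => by rw [hγ'']
  -- project an `A`-combination of the `z^α` to degree `0`
  have key : ∀ y ∈ Ideal.span {m | ∃ α : κ → ℕ, N ≤ ∑ k, α k * n k ∧ m = ∏ k, z k ^ α k},
      ∀ a : A, (decompose 𝒜 (a * y) 0 : A) ∈ ⨆ (N' : ℕ) (_ : N ≤ N'),
        (weightedHomogeneousSubmodule C (fun b : B => ∑ k, (b : κ → ℕ) k * n k) N').map
          (aeval (fun b : B => ∏ k, z k ^ (b : κ → ℕ) k)).toLinearMap := by
    intro y hy
    induction hy using Submodule.span_induction with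
    | mem m hm =>
      obtain ⟨α, hα, rfl⟩ := hm
      intro a
      rw [decompose_mul_of_mem 𝒜 (hzmon α), zero_sub]
      have hc := le_span_monomials' 𝒜 h0 z e hze hgen (-∑ k, α k • e k)
        (SetLike.coe_mem (decompose 𝒜 a (-∑ k, α k • e k)))
      have h1 := Submodule.apply_mem_span_image_of_mem_span
        (LinearMap.mulRight C (∏ k, z k ^ α k)) hc
      rw [LinearMap.mulRight_apply] at h1
      refine (Submodule.span_le.2 ?_) h1
      rintro _ ⟨_, ⟨β, hβ, rfl⟩, rfl⟩
      rw [SetLike.mem_coe, LinearMap.mulRight_apply, ← Finset.prod_mul_distrib]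
      simp_rw [← pow_add]
      refine hmon (fun k => β k + α k) ?_ ?_
      · simp only [add_smul, Finset.sum_add_distrib, hβ, neg_add_cancel]
      · refine hα.trans (Finset.sum_le_sum fun k _ => Nat.mul_le_mul_right _ (Nat.le_add_left _ _))
    | zero =>
      intro a
      rw [mul_zero, decompose_zero, DirectSum.zero_apply, ZeroMemClass.coe_zero]
      exact zero_mem _
    | add s t _ _ hs ht =>
      intro a
      rw [mul_add, decompose_add, DirectSum.add_apply, AddMemClass.coe_add]
      exact add_mem (hs a) (ht a)
    | smul c s _ hs =>
      intro a
      rw [smul_eq_mul, ← mul_assoc]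
      exact hs (a * c)
  have h := key x (hspan N x hxN) 1
  rwa [one_mul, decompose_of_mem_same 𝒜 hx0] at h

end DegreeZero

/-- **Sub-goal `stub_qs_degree_veronese`** registered on the crux item for this helper file of stub
`stub_qs_degree`: eventually standard tails of a weighted polynomial ring (`exists_tail_veronese`).
[folklore; Bourbaki, Alg. Comm. III §1 no. 3] -/
theorem stub_qs_degree_veronese :
    ∀ (C : Type) [CommRing C] {σ : Type} [Fintype σ] (w : σ → ℕ),
      ∃ d : ℕ, 0 < d ∧ ∀ d' : ℕ, d ∣ d' → ∀ l : ℕ, 0 < l → ∀ N' : ℕ, d' * (l + 1) ≤ N' →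
        MvPolynomial.weightedHomogeneousSubmodule C w N' ≤
          MvPolynomial.weightedHomogeneousSubmodule C w d' *
            MvPolynomial.weightedHomogeneousSubmodule C w (N' - d') := by
  intro C _ σ _ w
  exact exists_tail_veronese C w

end Summit.ResolutionOfSingularities.ResolutionOfSingularities.Theorems.DatumToEmbedded.Degree
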